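import Literature.AlgebraicGeometry.Motives.AbelianVarietyWeights
import Literature.AlgebraicGeometry.Motives.AlgebraicCorrespondencesRationalCharpoly
import Literature.AlgebraicGeometry.Motives.KunnethProjectorsDualityAndProducts
import HarnessLib

/-!
# The Künneth projectors of an abelian variety are algebraic (Lieberman–Kleiman), for every Weil
# cohomology and without hard Lefschetz

S. Kleiman, *Algebraic cycles and the Weil conjectures* (1968), Appendix 2A (after Lieberman): on
an abelian variety `A` the multiplication `n_A` acts on `Hⁱ(A)` as `nⁱ`, and "the graphs of the
isogenies `n_A` are algebraic, so by interpolation (Vandermonde in the eigenvalues `nⁱ`) the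
bihomogeneous components of algebraic correspondences on `A × A` are algebraic" (as summarised
in the tree's `Literature.AlgebraicGeometry.Motives.standardConjectureB_abelianVariety`); in
particular the Künneth components of the diagonal are algebraic — B. Kahn, *Zeta and
L-functions of varieties and motives* (2020), Thm. 6.31 (3): "If `A` is an abelian variety, all
the `p_A^i` are algebraic. … This theorem is due to Lieberman–Kleiman".

The tree proves `B(A)` (`standardConjectureB_abelianVariety_holds`), hence `C(A)`, **under the
hard Lefschetz hypothesis `W.HasHardLefschetz`**. This file proves `C(A)` for **every** Weil
cohomology theory `W : WeilCohomology k K`, with no Lefschetz hypothesis, by the printed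
interpolation argument in the form of `KunnethProjectorsPolynomialInCorrespondence`
(`standardConjectureC_of_isCoprime`): the degree-preserving algebraic correspondence `[2]^*`
(pull-back along multiplication by `2`, algebraic in all degrees by the graph) satisfies
`[2]^* = 2ʲ` on `Hʲ(A)` (`AbelianVarietyWeights.pullback_pow_eq_pow_smul`, purity of weights), so
the rational polynomials `t - 2ʲ`, pairwise coprime, annihilate its components, and each Künneth
projector is a rational (Lagrange) polynomial in `[2]^*`.

## Main statements (`A : AbelianVariety k`, `hA : IsSmoothProjective g A.X`)

* `standardConjectureC_abelianVariety`: **`C(A)` for every Weil cohomology theory**;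
  `exists_isDegreeProjector_eq_aeval_pullback_two`: `πⁱ = Qᵢ([2]^*)`, `Qᵢ ∈ ℚ[t]`.
* `isAlgebraicOperator_pullback_abelianVariety`, `exists_charpoly_pullback_eq_map_abelianVariety`:
  for every `k`-endomorphism `f` of the variety `A`, `f* | Hⁱ(A)` is algebraic and its
  characteristic polynomial is rational (Weil: Mumford, *Abelian varieties* §19 Thm. 4, for
  endomorphisms on `H¹ = T_ℓ ⊗ ℚ_ℓ`, with integer coefficients; here rational, every `W`, every
  degree), via `AlgebraicCorrespondencesRationalCharpoly`;
* `standardConjectureC_abelianVariety_tensor`: `C(A × Z)` whenever `C(Z)`.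

Theorems only; no definition, no named fact; `C`, `IsAlgebraicOperator`, `[n] = (𝟙 A.X)^n`
(Mathlib's `Hom.monoid` on points of the group object) are the tree's.

## References

* [Kleiman1968AlgebraicCycles] S. Kleiman, *Algebraic cycles and the Weil conjectures*, in: Dix
  exposés sur la cohomologie des schémas (1968), 359–386, Appendix 2A (Thm. 2A11 and the
  interpolation argument).
* [Kahn2020] B. Kahn, *Zeta and L-functions of varieties and motives* (2020), §6.9 Thm. 6.31 (3).
* [MumfordAV1970] D. Mumford, *Abelian varieties* (1970), §19 Thm. 4 (characteristic polynomial
  of an endomorphism).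
-/

universe u v

open CategoryTheory AlgebraicGeometry MonoidalCategory CartesianMonoidalCategory Polynomial

noncomputable section

namespace Literature.AlgebraicGeometry.Motives

namespace WeilCohomology

variable {k : Type u} [Field k] {K : Type v} [Field K] [CharZero K] (W : WeilCohomology k K)

section AbelianVariety

open scoped MonObj

variable {g : ℕ} (A : AbelianVariety k)

/-- On a smooth projective abelian variety of dimension `g` there is a degree-`2` class with
non-zero `g`-th power: a hyperplane class (`deg A = tr ηᵍ > 0`, axioms `isHyperplaneClass_nonempty`,
`trace_pow_of_isHyperplaneClass`) when `g ≥ 1`, and `0⁰ = 1 ≠ 0` when `g = 0`. (The non-degeneracy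
input of Kleiman's Appendix 2A.) [cite: Kleiman1968AlgebraicCycles, Appendix 2A] -/
theorem exists_pow_ne_zero_of_isSmoothProjective {X : SchemeOver k} (hX : IsSmoothProjective g X) :
    ∃ w : W.obj X 2, W.pow X w g ≠ 0 := by
  rcases Nat.eq_zero_or_pos g with hg | hg
  · subst hg
    exact ⟨0, by rw [PreWeilCohomology.pow_zero]; exact W.unit_ne_zero hX⟩
  · obtain ⟨w, hw⟩ := W.isHyperplaneClass_nonempty hX hg
    obtain ⟨d, hd, htr⟩ := W.trace_pow_of_isHyperplaneClass hX w hw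
    refine ⟨w, fun h0 ↦ ?_⟩
    rw [h0, map_zero] at htr
    exact (Nat.cast_ne_zero.mpr hd.ne') htr.symm

/-- **`[a]^* - aᵈ` annihilates `Hᵈ(A)`**: the rational polynomial `t - aᵈ` kills the pull-back
along multiplication by `a` on `Hᵈ(A)` (purity `[a]^* = aᵈ`, `pullback_pow_eq_pow_smul`;
Kleiman 1968 2A, Mumford §15). [cite: Kleiman1968AlgebraicCycles, Appendix 2A] -/
theorem aeval_pullback_pow_X_sub_C (hA : IsSmoothProjective g A.X) (a d : ℕ) :
    aeval (W.pullback ((𝟙 A.X) ^ a) d) ((X - C (((a : ℚ)) ^ d)).map (algebraMap ℚ K)) = 0 := by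
  obtain ⟨w, hw⟩ := W.exists_pow_ne_zero_of_isSmoothProjective hA
  have hF : W.pullback ((𝟙 A.X) ^ a) d = ((a : K) ^ d) • LinearMap.id :=
    LinearMap.ext fun x ↦ by
      rw [W.pullback_pow_eq_pow_smul A hA hw d a x, LinearMap.smul_apply, LinearMap.id_apply]
  rw [Polynomial.map_sub, Polynomial.map_X, Polynomial.map_C, map_sub, Polynomial.aeval_X,
    Polynomial.aeval_C, hF, Algebra.algebraMap_eq_smul_one, map_pow, map_natCast]
  exact sub_self _

/-- The annihilating polynomials `t - 2ⁱ`, `t - 2ʲ` are coprime for `i ≠ j`.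
[cite: Kleiman1968AlgebraicCycles, Appendix 2A] -/
theorem isCoprime_X_sub_C_two_pow {i j : ℕ} (hij : i ≠ j) :
    IsCoprime (X - C (((2 : ℕ) : ℚ) ^ i)) (X - C (((2 : ℕ) : ℚ) ^ j)) := by
  refine Polynomial.isCoprime_X_sub_C_of_isUnit_sub (isUnit_iff_ne_zero.mpr (sub_ne_zero.mpr ?_))
  rw [← Nat.cast_pow, ← Nat.cast_pow, Ne, Nat.cast_inj]
  exact fun h ↦ hij (Nat.pow_right_injective (le_refl 2) h)

/-- **Lieberman–Kleiman: the Künneth projectors of an abelian variety are rational polynomials in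
`[2]^*`** — for every Weil cohomology theory, without any Lefschetz hypothesis: for each `i` there
are `Q ∈ ℚ[t]` and an algebraic graded operator `P` on `H•(A)` which is the `i`-th Künneth
projector and whose components are `Q([2]^* | Hʲ(A))` (interpolation in the eigenvalues `2ʲ` of
`[2]^*`, Kleiman 1968 Appendix 2A; mechanism `exists_isDegreeProjector_aeval_of_isCoprime`).
[cite: Kleiman1968AlgebraicCycles, Appendix 2A] [cite: Kahn2020, §6.9 Thm. 6.31 (3)] -/
theorem exists_isDegreeProjector_eq_aeval_pullback_two (hA : IsSmoothProjective g A.X) (i : ℕ) :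
    ∃ (Q : ℚ[X]) (P : W.GradedOp A.X A.X), W.IsAlgebraicGradedOp g g P ∧
      W.IsDegreeProjector A.X i P ∧ (∀ a b : ℕ, a ≠ b → P a b = 0) ∧
        ∀ j : ℕ, P j j = aeval (W.pullback ((𝟙 A.X) ^ 2) j) (Q.map (algebraMap ℚ K)) := by
  obtain ⟨Q, P, hPalg, hPdeg, hPdiag, hP⟩ := W.exists_isDegreeProjector_aeval_of_isCoprime hA
    (W.isAlgebraicGradedOp_degreewise_pullback hA hA ((𝟙 A.X) ^ 2))
    (fun a b hab ↦ PreWeilCohomology.GradedOp.degreewise_apply_of_ne _ hab)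
    (fun j ↦ X - C (((2 : ℕ) : ℚ) ^ j))
    (fun j _ ↦ by
      rw [PreWeilCohomology.GradedOp.ofLinearMap_apply_same]
      exact W.aeval_pullback_pow_X_sub_C A hA 2 j)
    (fun a _ b _ hab ↦ isCoprime_X_sub_C_two_pow hab) i
  refine ⟨Q, P, hPalg, hPdeg, hPdiag, fun j ↦ ?_⟩
  rw [hP j, PreWeilCohomology.GradedOp.ofLinearMap_apply_same]

/-- **`C(A)` for abelian varieties, for every Weil cohomology theory** (Lieberman–Kleiman;
Kleiman 1968 Appendix 2A; Kahn 2020 Thm. 6.31 (3): "If `A` is an abelian variety, all the `p_A^i`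
are algebraic"): every Künneth projector of a smooth projective abelian variety is induced by an
algebraic correspondence with `ℚ`-coefficients. Unlike the tree's route through `B(A)`
(`standardConjectureB_abelianVariety_holds`), no hard Lefschetz hypothesis is needed.
[cite: Kleiman1968AlgebraicCycles, Appendix 2A] [cite: Kahn2020, §6.9 Thm. 6.31 (3)] -/
theorem standardConjectureC_abelianVariety (hA : IsSmoothProjective g A.X) :
    W.StandardConjectureC g A.X := fun i ↦ by
  obtain ⟨-, P, hPalg, hPdeg, -, -⟩ := W.exists_isDegreeProjector_eq_aeval_pullback_two A hA i
  exact ⟨P, hPdeg, hPalg⟩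

/-- Single-degree form: every `πⁱ` of an abelian variety is algebraic, for every `W`.
[cite: Kahn2020, §6.9 Thm. 6.31 (3)] -/
theorem isAlgebraicOperator_id_abelianVariety (hA : IsSmoothProjective g A.X) (i : ℕ) :
    W.IsAlgebraicOperator g g (LinearMap.id : W.obj A.X i →ₗ[K] W.obj A.X i) :=
  W.standardConjectureC_iff.mp (W.standardConjectureC_abelianVariety A hA) i

/-! ## Consequences: endomorphisms, characteristic polynomials, products -/

/-- **`f* | Hⁱ(A)` is algebraic** for every `k`-endomorphism `f` of the underlying variety of an
abelian variety (in particular for every endomorphism and every translate), for every Weil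
cohomology theory: the graph of `f` induces `f*` in all degrees and `πⁱ` cuts out the component.
[cite: Kleiman1968AlgebraicCycles, Appendix 2A] -/
theorem isAlgebraicOperator_pullback_abelianVariety (hA : IsSmoothProjective g A.X)
    (f : A.X ⟶ A.X) (i : ℕ) : W.IsAlgebraicOperator g g (W.pullback f i) :=
  W.isAlgebraicOperator_pullback hA hA f (W.isAlgebraicOperator_id_abelianVariety A hA i)
    (W.isAlgebraicOperator_id_abelianVariety A hA i)

/-- **The characteristic polynomial of an endomorphism of an abelian variety on `Hⁱ(A)` is
rational**, for every Weil cohomology theory and every degree `i` (Weil's theorem, Mumford §19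
Thm. 4, for `H¹`, with integer coefficients; Kleiman 1968 2A): `det(t - f* | Hⁱ(A))` is the image
of a polynomial in `ℚ[t]` (powers of the algebraic operator `f*|Hⁱ` have rational traces by the
Lefschetz trace formula). [cite: MumfordAV1970, §19 Thm. 4] [cite: Kleiman1968AlgebraicCycles, Appendix 2A] -/
theorem exists_charpoly_pullback_eq_map_abelianVariety (hA : IsSmoothProjective g A.X)
    (f : A.X ⟶ A.X) (i : ℕ) :
    ∃ P : ℚ[X], (haveI := W.finite_obj hA i; (W.pullback f i).charpoly) = P.map (algebraMap ℚ K) :=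
  W.exists_charpoly_eq_map_of_isAlgebraicOperator hA (W.isAlgebraicOperator_id_abelianVariety A hA i)
    (W.isAlgebraicOperator_pullback_abelianVariety A hA f i)

/-- The determinant `det(f* | Hⁱ(A))` of an endomorphism is rational, for every `W`
(for `i = 1` and an isogeny this is its degree up to sign in the classical theories, Mumford §19).
[cite: MumfordAV1970, §19 Thm. 4] -/
theorem exists_det_pullback_eq_ratCast_abelianVariety (hA : IsSmoothProjective g A.X)
    (f : A.X ⟶ A.X) (i : ℕ) : ∃ q : ℚ, LinearMap.det (W.pullback f i) = q :=
  W.exists_det_eq_ratCast_of_isAlgebraicOperator hA (W.isAlgebraicOperator_id_abelianVariety A hA i)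
    (W.isAlgebraicOperator_pullback_abelianVariety A hA f i)

/-- Every algebraic correspondence on `Hⁱ(A)` has a rational characteristic polynomial, for every
`W` (`C(A)` and `exists_charpoly_eq_map_of_isAlgebraicOperator`). [cite: Kahn2020, §6.12 Cor. 6.44]
[cite: Kleiman1968AlgebraicCycles, Appendix 2A] -/
theorem exists_charpoly_eq_map_abelianVariety (hA : IsSmoothProjective g A.X) {i : ℕ}
    {T : W.obj A.X i →ₗ[K] W.obj A.X i} (hT : W.IsAlgebraicOperator g g T) :
    ∃ P : ℚ[X], (haveI := W.finite_obj hA i; T.charpoly) = P.map (algebraMap ℚ K) :=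
  W.exists_charpoly_eq_map_of_isAlgebraicOperator hA (W.isAlgebraicOperator_id_abelianVariety A hA i) hT

/-- The inverse of an algebraic automorphism of `Hⁱ(A)` is algebraic, for every `W`
(Lieberman's lemma, unconditional on abelian varieties). [cite: Kleiman1968AlgebraicCycles, Appendix 2A] -/
theorem isAlgebraicOperator_of_comp_eq_id_abelianVariety (hA : IsSmoothProjective g A.X) {i : ℕ}
    {T T' : W.obj A.X i →ₗ[K] W.obj A.X i} (hT : W.IsAlgebraicOperator g g T)
    (h₁ : T' ∘ₗ T = LinearMap.id) (h₂ : T ∘ₗ T' = LinearMap.id) : W.IsAlgebraicOperator g g T' :=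
  hT.of_comp_eq_id hA (W.isAlgebraicOperator_id_abelianVariety A hA i) h₁ h₂

/-- **`C(A × Z)` whenever `C(Z)`**, for an abelian variety `A` and every `W` (products,
`standardConjectureC_tensor`). [cite: Kahn2020, §6.9 Lemma 6.30 (3)] [cite: Kahn2020, §6.9 Thm. 6.31 (3)] -/
theorem standardConjectureC_abelianVariety_tensor (hA : IsSmoothProjective g A.X) {m : ℕ}
    {Z : SchemeOver k} (hZ : IsSmoothProjective m Z) (hCZ : W.StandardConjectureC m Z) :
    W.StandardConjectureC (g + m) (A.X ⊗ Z) :=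
  W.standardConjectureC_tensor hA hZ (W.standardConjectureC_abelianVariety A hA) hCZ

/-- `C(A × B)` for two abelian varieties (or rather their underlying varieties), every `W`.
[cite: Kahn2020, §6.9 Thm. 6.31 (3)] -/
theorem standardConjectureC_abelianVariety_tensor_abelianVariety (hA : IsSmoothProjective g A.X)
    {g' : ℕ} (B : AbelianVariety k) (hB : IsSmoothProjective g' B.X) :
    W.StandardConjectureC (g + g') (A.X ⊗ B.X) :=
  W.standardConjectureC_abelianVariety_tensor A hA hB (W.standardConjectureC_abelianVariety B hB)

/-- `C(A × X)` for an abelian variety `A` and a curve `X`, every `W`.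
[cite: Kahn2020, §6.9 Thm. 6.31] -/
theorem standardConjectureC_abelianVariety_tensor_curve (hA : IsSmoothProjective g A.X)
    {X : SchemeOver k} (hX : IsSmoothProjective 1 X) : W.StandardConjectureC (g + 1) (A.X ⊗ X) :=
  W.standardConjectureC_abelianVariety_tensor A hA hX (W.standardConjectureC_curve hX)

end AbelianVariety

end WeilCohomology

end Literature.AlgebraicGeometry.Motives

end
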